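import Summits.ValiantsHypothesis.ValiantsHypothesis.Theorems.KPlusLogSqLawTropicalGradedRows

/-!
# Route «KPlusLogSqLaw», crux `WeakLifting` (stmt-ValiantsHypothesis-19561), docket D2 — PAGE RESTRICTION: a page of dominant terms is a
# dominant chain of its own union support with the top class FLATTENED (exponent `0`), and a row likewise with the two top classes flattened

HONEST FRAMING.  Helper file (cell `pub-symmetroid`, seat val-sym-lift-p3 g25, 2026-08-29) `--supports` the crux
`Summit.ValiantsHypothesis.ValiantsHypothesis.Theses.KPlusLogSqLaw.WeakLifting` (ledger item `stmt-ValiantsHypothesis-19561`, route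
`KPlusLogSqLaw`; lineage docket D2 = the `K = 4` tropical exponent fork).  Kernel form of §3b («window sampling») of the lineage memo
HOME/val-sym-lift-p3/g4/K4-PAGE-RIGIDITY-AND-CARRIES.md in the generality the tree supports (arbitrary designs, not only static ones):
STRUCTURE laws for dominant terms in the lex regime; they bound no tropical row by themselves, decide nothing about the fork, and assert
nothing about `WeakLifting`, `TropicalB`, `Lifting`, `KPlusLogSqLaw`, `MatrixDescartes` (stmt-ValiantsHypothesis-18050) or VP ≠ VNP.

SETTING (as in `TropicalCensus.classCount_eq_of_recombination`, p494347): class `l⋆` with `d l ≤ D` (`l ≠ l⋆`) and `(k/2)·m·D ≤ d l⋆`; terms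
`t₀..t_{k−1}` (`k ≥ 1`) dominant at strictly increasing slopes with equal `l⋆`-count `c` (one PAGE).  The RESTRICTED presence pattern keeps an
incidence `(a, i, l)` iff some `t r` uses it: `εU a i l = if (∃ r, (t r).1 i = a ∧ (t r).2 i = l) then ε a i l else 0`; the FLATTENED exponents
are `d♭ l = if l = l⋆ then 0 else d l`.

* `tropWeight_flatten` — `tropWeight d v θ q = tropWeight d♭ v θ q + θ·(d l⋆)·#{i : q.2 i = l⋆}`.
* `termSign_restrict_of_ne_zero` / `exists_sel_of_termSign_restrict` — a term present in the restricted pattern is present in the original one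
  with the same sign, and is recombined columnwise from the `t`'s.
* `isDominant_restrict_flatten` — **PAGE RESTRICTION**: every `t r` is dominant AT THE SAME SLOPE in the design `(d♭, v, εU)`: the competitors
  there are exactly the columnwise recombinations of the page, all of which carry `c` entries of class `l⋆` (page rigidity), so flattening
  shifts every weight by the same `θ·c·d l⋆`.  Hence a page is a dominant chain of a design in which the top class is SLOPE-FREE: whatever
  row bound holds for such designs on the page's own support bounds the page length (`page_le_of_row_bound`).
* `isDominant_restrict_flatten_two` — **ROW RESTRICTION**: with a second class `l₂` in the regime of `BandRigidity.exists_rowGrading`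
  (equal `l⋆`- and `l₂`-counts: one ROW), every `t r` is dominant at the same slope in `(d♭♭, v, εU)` with BOTH `l⋆` and `l₂` flattened — a
  row is a dominant chain of a design with only the classes below `l₂` carrying slope («a window of the `K = 2`-type sequence of its own
  union support», for `K = 4`).
[folklore bookkeeping over p494347 / p721993 and the companion files; the packaging is the cell's]
-/

set_option linter.dupNamespace false
set_option autoImplicit false

namespace Summit.ValiantsHypothesis.ValiantsHypothesis.Theorems.KPlusLogSqLaw

open Summit.ValiantsHypothesis.ValiantsHypothesis.Theorems.MatrixDescartes.Negative
open Summit.ValiantsHypothesis.ValiantsHypothesis.Theorems.LacunarySymmetroidMatrixDescartes.TropicalCensus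
open scoped BigOperators
open Finset

namespace PageRestriction

variable {m K : ℕ}

/-- Flattening one class: `tropWeight d = tropWeight d♭ + θ·(d l⋆)·(l⋆-count)`. [folklore] -/
theorem tropWeight_flatten (d : Fin K → ℕ) (v : Fin m → Fin m → Fin K → ℤ) (θ : ℤ) (lstar : Fin K)
    (q : Equiv.Perm (Fin m) × (Fin m → Fin K)) :
    tropWeight d v θ q = tropWeight (fun l => if l = lstar then 0 else d l) v θ q
      + θ * (d lstar : ℤ) * ((univ.filter fun i => q.2 i = lstar).card : ℤ) := by
  classical
  unfold tropWeight
  have h : ∑ i, (d (q.2 i) : ℤ) = ∑ i, ((if q.2 i = lstar then 0 else d (q.2 i) : ℕ) : ℤ)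
      + (d lstar : ℤ) * ((univ.filter fun i => q.2 i = lstar).card : ℤ) := by
    rw [pageRigid_count_eq_sum_ite, mul_sum, ← sum_add_distrib]
    refine sum_congr rfl fun i _ => ?_
    by_cases hi : q.2 i = lstar
    · rw [if_pos hi, if_pos hi, hi]; simp
    · rw [if_neg hi, if_neg hi]; simp
  rw [h]
  ring

/-- A term present in the restricted pattern is present in the original one, with the same sign. -/
theorem termSign_restrict_eq {k : ℕ} (ε : Fin m → Fin m → Fin K → ℤ) (t : Fin k → Equiv.Perm (Fin m) × (Fin m → Fin K))
    (q : Equiv.Perm (Fin m) × (Fin m → Fin K))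
    (hq : termSign (fun a i l => if (∃ r, (t r).1 i = a ∧ (t r).2 i = l) then ε a i l else 0) q ≠ 0) :
    termSign ε q = termSign (fun a i l => if (∃ r, (t r).1 i = a ∧ (t r).2 i = l) then ε a i l else 0) q := by
  classical
  unfold termSign at hq ⊢
  congr 1
  refine prod_congr rfl fun i _ => ?_
  have hprod := (mul_ne_zero_iff.mp hq).2
  rw [prod_ne_zero_iff] at hprod
  have hi := hprod i (mem_univ i)
  by_cases h : ∃ r, (t r).1 i = q.1 i ∧ (t r).2 i = q.2 i
  · simp only [if_pos h]
  · simp only [if_neg h] at hi; exact absurd rfl hi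

/-- A term present in the restricted pattern is recombined columnwise from the `t`'s. -/
theorem exists_sel_of_termSign_restrict {k : ℕ} (ε : Fin m → Fin m → Fin K → ℤ) (t : Fin k → Equiv.Perm (Fin m) × (Fin m → Fin K))
    (q : Equiv.Perm (Fin m) × (Fin m → Fin K))
    (hq : termSign (fun a i l => if (∃ r, (t r).1 i = a ∧ (t r).2 i = l) then ε a i l else 0) q ≠ 0) :
    ∀ i, ∃ r, (t r).1 i = q.1 i ∧ (t r).2 i = q.2 i := by
  classical
  intro i
  unfold termSign at hq
  have hprod := (mul_ne_zero_iff.mp hq).2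
  rw [prod_ne_zero_iff] at hprod
  have hi := hprod i (mem_univ i)
  by_contra h
  simp only [if_neg h] at hi
  exact hi rfl

/-- The restricted pattern has signs in `{−1, 0, 1}` if the original one has. -/
theorem natAbs_restrict_le {k : ℕ} (ε : Fin m → Fin m → Fin K → ℤ) (hε : ∀ i j l, (ε i j l).natAbs ≤ 1)
    (t : Fin k → Equiv.Perm (Fin m) × (Fin m → Fin K)) (a i : Fin m) (l : Fin K) :
    ((fun a i l => if (∃ r, (t r).1 i = a ∧ (t r).2 i = l) then ε a i l else 0) a i l).natAbs ≤ 1 := by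
  classical
  simp only
  split_ifs
  · exact hε a i l
  · simp

/-- **PAGE RESTRICTION.**  Under the hypotheses of `classCount_eq_of_recombination`, every page term is dominant at the same slope in the
design restricted to the page's union support with the top class flattened to exponent `0`. -/
theorem isDominant_restrict_flatten {k : ℕ} (d : Fin K → ℕ) (v ε : Fin m → Fin m → Fin K → ℤ)
    (θ : Fin k → ℤ) (hθ : StrictMono θ) (t : Fin k → Equiv.Perm (Fin m) × (Fin m → Fin K))
    (hdom : ∀ r, IsDominant d v ε (θ r) (t r))
    (lstar : Fin K) (D : ℕ) (hD : ∀ l, l ≠ lstar → d l ≤ D) (hlex : (k / 2) * m * D ≤ d lstar)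
    (c : ℕ) (hc : ∀ r, (univ.filter fun i => (t r).2 i = lstar).card = c) (hk : 0 < k) (r : Fin k) :
    IsDominant (fun l => if l = lstar then 0 else d l) v
      (fun a i l => if (∃ r, (t r).1 i = a ∧ (t r).2 i = l) then ε a i l else 0) (θ r) (t r) := by
  classical
  set εU : Fin m → Fin m → Fin K → ℤ := fun a i l => if (∃ r, (t r).1 i = a ∧ (t r).2 i = l) then ε a i l else 0 with hεU
  -- the page term itself is present in the restricted pattern
  have hpres : termSign εU (t r) ≠ 0 := by
    have h1 : termSign εU (t r) = termSign ε (t r) := by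
      unfold termSign
      congr 1
      refine prod_congr rfl fun i _ => ?_
      simp only [hεU, if_pos (⟨r, rfl, rfl⟩ : ∃ r', (t r').1 i = (t r).1 i ∧ (t r').2 i = (t r).2 i)]
    rw [h1]; exact (hdom r).1
  refine ⟨hpres, fun q hq hqs => ?_⟩
  -- a competitor is recombined from the page, hence has top count `c`, and is present in the original design
  have hsel := exists_sel_of_termSign_restrict ε t q hqs
  choose sel hsel using hsel
  have hbij : Function.Bijective fun i => (t (sel i)).1 i := by
    have : (fun i => (t (sel i)).1 i) = q.1 := funext fun i => (hsel i).1
    rw [this]; exact q.1.bijective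
  have hcq : (univ.filter fun i => q.2 i = lstar).card = c := by
    have h := classCount_eq_of_recombination d v ε θ hθ t hdom lstar D hD hlex c hc hk sel hbij
    rw [← h]; congr 1; ext i; simp [(hsel i).2]
  have hqε : termSign ε q ≠ 0 := by rw [termSign_restrict_eq ε t q hqs]; exact hqs
  have hlt := (hdom r).2 q hq hqε
  rw [tropWeight_flatten d v (θ r) lstar q, tropWeight_flatten d v (θ r) lstar (t r), hcq, hc r] at hlt
  linarith

/-- **Page length through any row bound of the flattened restricted design.**  If every sign-alternating dominant chain of the flattened
restricted design has at most `B` steps (hypothesis `hrow` — e.g. an instance of a tropical row law for that design), and the page's signs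
alternate, then the page has at most `B` steps. -/
theorem page_le_of_row_bound {k : ℕ} (d : Fin K → ℕ) (v ε : Fin m → Fin m → Fin K → ℤ)
    (θ : Fin (k + 1) → ℤ) (hθ : StrictMono θ) (t : Fin (k + 1) → Equiv.Perm (Fin m) × (Fin m → Fin K))
    (hdom : ∀ r, IsDominant d v ε (θ r) (t r))
    (lstar : Fin K) (D : ℕ) (hD : ∀ l, l ≠ lstar → d l ≤ D) (hlex : ((k + 1) / 2) * m * D ≤ d lstar)
    (c : ℕ) (hc : ∀ r, (univ.filter fun i => (t r).2 i = lstar).card = c)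
    (halt : ∀ r : Fin k, termSign ε (t r.castSucc) * termSign ε (t r.succ) < 0)
    (B : ℕ)
    (hrow : ∀ (n : ℕ) (θ' : Fin (n + 1) → ℤ) (p : Fin (n + 1) → Equiv.Perm (Fin m) × (Fin m → Fin K)),
      StrictMono θ' →
      (∀ r, IsDominant (fun l => if l = lstar then 0 else d l) v
        (fun a i l => if (∃ r, (t r).1 i = a ∧ (t r).2 i = l) then ε a i l else 0) (θ' r) (p r)) →
      (∀ r : Fin n, termSign (fun a i l => if (∃ r, (t r).1 i = a ∧ (t r).2 i = l) then ε a i l else 0) (p r.castSucc) *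
        termSign (fun a i l => if (∃ r, (t r).1 i = a ∧ (t r).2 i = l) then ε a i l else 0) (p r.succ) < 0) → n ≤ B) :
    k ≤ B := by
  classical
  refine hrow k θ t hθ (fun r => isDominant_restrict_flatten d v ε θ hθ t hdom lstar D hD hlex c hc (Nat.succ_pos k) r) ?_
  intro r
  have h1 := isDominant_restrict_flatten d v ε θ hθ t hdom lstar D hD hlex c hc (Nat.succ_pos k) r.castSucc
  have h2 := isDominant_restrict_flatten d v ε θ hθ t hdom lstar D hD hlex c hc (Nat.succ_pos k) r.succ
  rw [← termSign_restrict_eq ε t _ h1.1, ← termSign_restrict_eq ε t _ h2.1]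
  exact halt r

/-- **ROW RESTRICTION.**  In the regime of `BandRigidity.classCount_two_eq_of_recombination` (classes `l₃ ≠ l₂` both lex-dominant, terms with
equal `l₃`-count `c₃` and equal `l₂`-count `c₂`: one ROW), every row term is dominant at the same slope in the design restricted to the row's
union support with BOTH classes `l₃`, `l₂` flattened to exponent `0` — only the classes below `l₂` carry slope there. -/
theorem isDominant_restrict_flatten_two {k : ℕ} (d : Fin K → ℕ) (v ε : Fin m → Fin m → Fin K → ℤ)
    (θ : Fin k → ℤ) (hθ : StrictMono θ) (t : Fin k → Equiv.Perm (Fin m) × (Fin m → Fin K))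
    (hdom : ∀ r, IsDominant d v ε (θ r) (t r))
    (l₃ l₂ : Fin K) (h23 : l₂ ≠ l₃)
    (D₃ : ℕ) (hD3 : ∀ l, l ≠ l₃ → d l ≤ D₃) (hlex3 : (k / 2) * m * D₃ ≤ d l₃)
    (D₂ : ℕ) (hD2 : ∀ l, l ≠ l₃ → l ≠ l₂ → d l ≤ D₂) (hlex2 : (k / 2) * m * D₂ ≤ d l₂)
    (c₃ : ℕ) (hc3 : ∀ r, (univ.filter fun i => (t r).2 i = l₃).card = c₃)
    (c₂ : ℕ) (hc2 : ∀ r, (univ.filter fun i => (t r).2 i = l₂).card = c₂) (hk : 0 < k) (r : Fin k) :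
    IsDominant (fun l => if l = l₂ then 0 else if l = l₃ then 0 else d l) v
      (fun a i l => if (∃ r, (t r).1 i = a ∧ (t r).2 i = l) then ε a i l else 0) (θ r) (t r) := by
  classical
  set εU : Fin m → Fin m → Fin K → ℤ := fun a i l => if (∃ r, (t r).1 i = a ∧ (t r).2 i = l) then ε a i l else 0 with hεU
  have h3 := isDominant_restrict_flatten d v ε θ hθ t hdom l₃ D₃ hD3 hlex3 c₃ hc3 hk r
  refine ⟨h3.1, fun q hq hqs => ?_⟩
  -- a competitor is recombined from the row, hence has `l₂`-count `c₂`
  have hsel := exists_sel_of_termSign_restrict ε t q hqs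
  choose sel hsel using hsel
  have hbij : Function.Bijective fun i => (t (sel i)).1 i := by
    have : (fun i => (t (sel i)).1 i) = q.1 := funext fun i => (hsel i).1
    rw [this]; exact q.1.bijective
  have hcq : (univ.filter fun i => q.2 i = l₂).card = c₂ := by
    have h := BandRigidity.classCount_two_eq_of_recombination d v ε θ hθ t hdom l₃ l₂ h23 D₃ hD3 hlex3 D₂ hD2 hlex2 c₃ hc3
      c₂ hc2 hk sel hbij
    rw [← h]; congr 1; ext i; simp [(hsel i).2]
  have hlt := h3.2 q hq hqs
  rw [tropWeight_flatten (fun l => if l = l₃ then 0 else d l) v (θ r) l₂ q,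
    tropWeight_flatten (fun l => if l = l₃ then 0 else d l) v (θ r) l₂ (t r), hcq, hc2 r] at hlt
  have e2 : (fun l => if l = l₂ then 0 else (fun l => if l = l₃ then 0 else d l) l)
      = (fun l => if l = l₂ then 0 else if l = l₃ then 0 else d l) := by
    funext l; simp only
  rw [e2] at hlt
  linarith

end PageRestriction

end Summit.ValiantsHypothesis.ValiantsHypothesis.Theorems.KPlusLogSqLaw
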